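import Summits.CriticalPhenomena.PercolationContinuityZ3.Theorems.PercNearOneGluingNoHeavyLowerTailAntitheticDegTwoVertex
import Summits.CriticalPhenomena.PercolationContinuityZ3.Theorems.PercNearOneGluingNoHeavyLowerTailAntitheticCutVertex
import HarnessLib

/-!
# `NoHeavyLowerTail` (stmt-CriticalPhenomena-4575) — antithetic cluster pairs: THEOREM OS⊕-A + OS⊕-B assembled (prim-hp-2 gen 56)

Support file (`--supports stmt-CriticalPhenomena-4575`, hull-port prover `prim-hp-2`, gen 56).  No definitions, no named facts, no sorries;
standard axioms.  `Antithetic.DegTwo.deg2_vertex_of_termTwo`: at a degree-2 vertex `x` of any finite graph (neighbours `y ≠ z`, `yz ∉ E`),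
the vertex antithetic sum over `D({x})` is `≥ 0` as soon as the ONE-SIDED term `TII = Σ_{y ∈ X', z ∉ Y'} (F(X'∪{x}) − F(Y'))(G(X'∪{x}) − G(Y'))`
over the colourings of `G − x` is (`DegTwo.deg2_vertex_reduction` with TERM I discharged by `Antithetic.termOne_nonneg`).
**`Antithetic.DegTwo.cutVertex_vertex_sum_nonneg`** (THEOREM OS⊕-A+B+C): if moreover `s` separates `y` from `z` in `G − x`
(`E ∖ {xy, xz} = E₁ ∪ E₂` glued at `s` only) and side 1 is ⊕-POSITIVE at `y`, the vertex antithetic sum over `D({x})` is `≥ 0` — the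
cut-vertex composition theorem (`Antithetic.Cut.cutVertex_termTwo_nonneg`) supplies TERM II.  HOME/THEOREM-OneSided.md.
[cite: VandenbergHaggstromKahn2005, §1 p. 6 ("Harris' inequality")]
-/

noncomputable section

namespace Summit.CriticalPhenomena.PercolationContinuityZ3.Theorems

open Literature.Probability.Percolation
open scoped Classical

namespace Antithetic

namespace DegTwo

variable {V : Type*} [Fintype V] {E : Set (Sym2 V)} {s x y z : V} (hxs : x ≠ s) (hxy : x ≠ y) (hxz : x ≠ z) (hyz : y ≠ z)
  (he : s(x, y) ∈ E) (hf : s(x, z) ∈ E) (hdeg : ∀ h ∈ E, x ∈ h → h = s(x, y) ∨ h = s(x, z)) (hg : s(y, z) ∉ E)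
include hxs hxy hxz hyz he hf hdeg hg

/-- **The one-sided reduction, assembled** (THEOREM OS⊕-A + OS⊕-B): at a degree-2 vertex `x` (neighbours `y ≠ z`, `yz ∉ E`), the vertex
antithetic sum over `D({x})` is nonnegative as soon as the ONE-SIDED term
`TII = Σ_{ω : y ∈ X_{E'} ω, z ∉ Y_{E'} ω} (F(X_{E'} ω ∪ {x}) − F(Y_{E'} ω))(G(X_{E'} ω ∪ {x}) − G(Y_{E'} ω))` is (TERM I is
`Antithetic.termOne_nonneg`). [this work] -/
theorem deg2_vertex_of_termTwo {F G : Set V → ℝ} (hF : Monotone F) (hG : Monotone G)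
    (hTII : 0 ≤ ∑ ω ∈ Finset.univ.filter (fun ω : Set (Sym2 V) =>
        (openGraph (ω ∩ (E \ {s(x, y), s(x, z)}))).Reachable s y ∧ ¬ (openGraph (ωᶜ ∩ (E \ {s(x, y), s(x, z)}))).Reachable s z),
      (F (openCluster (ω ∩ (E \ {s(x, y), s(x, z)})) s ∪ {x}) - F (openCluster (ωᶜ ∩ (E \ {s(x, y), s(x, z)})) s)) *
        (G (openCluster (ω ∩ (E \ {s(x, y), s(x, z)})) s ∪ {x}) - G (openCluster (ωᶜ ∩ (E \ {s(x, y), s(x, z)})) s))) :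
    0 ≤ ∑ ω ∈ Finset.univ.filter (fun ω : Set (Sym2 V) =>
        ¬ ((openGraph (ω ∩ E)).Reachable s x ∧ (openGraph (ωᶜ ∩ E)).Reachable s x)),
      (F (openCluster (ω ∩ E) s) - F (openCluster (ωᶜ ∩ E) s)) * (G (openCluster (ω ∩ E) s) - G (openCluster (ωᶜ ∩ E) s)) :=
  deg2_vertex_reduction hxs hxy hxz hyz he hf hdeg hg hF hG (termOne_nonneg (E \ {s(x, y), s(x, z)}) s y z {x} hF hG) hTII


/-- **THEOREM OS⊕-A + B + C assembled (cut-vertex case of the vertex antithetic conjecture at a degree-2 vertex).**  `x` of degree 2 with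
neighbours `y ≠ z` (`yz ∉ E`); `E ∖ {xy, xz} = E₁ ∪ E₂` with the sides on disjoint vertex sets `U₁ ∋ y`, `U₂ ∋ z` glued at `s`; side 1
⊕-positive at `y` (for all twisted-monotone super-odd `K₁, K₂`, `Σ_{ω : y ∈ X₁ ω} K₁K₂(X₁ ω, Y₁ ω) ≥ 0`).  Then
`0 ≤ Σ_{ω : ¬(x ∈ X_E ω ∧ x ∈ Y_E ω)} (F(X_E ω) − F(Y_E ω))(G(X_E ω) − G(Y_E ω))` for all monotone `F, G`.  (FAT8 = both sides cherry fans.)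
[this work] -/
theorem cutVertex_vertex_sum_nonneg (E₁ E₂ : Set (Sym2 V)) (U₁ U₂ : Set V) (hE' : E \ {s(x, y), s(x, z)} = E₁ ∪ E₂)
    (hU : Disjoint U₁ U₂) (hs₁ : s ∉ U₁) (hs₂ : s ∉ U₂) (hE₁ : ∀ e ∈ E₁, ∀ v ∈ e, v = s ∨ v ∈ U₁)
    (hE₂ : ∀ e ∈ E₂, ∀ v ∈ e, v = s ∨ v ∈ U₂) (hdis : Disjoint E₁ E₂) (hyU : y ∈ U₁) (hzU : z ∈ U₂)
    (hplus : ∀ K₁ K₂ : Set V → Set V → ℝ,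
      (∀ ⦃P P' Q Q' : Set V⦄, P ⊆ P' → Q' ⊆ Q → K₁ P Q ≤ K₁ P' Q') → (∀ P Q, 0 ≤ K₁ P Q + K₁ Q P) →
      (∀ ⦃P P' Q Q' : Set V⦄, P ⊆ P' → Q' ⊆ Q → K₂ P Q ≤ K₂ P' Q') → (∀ P Q, 0 ≤ K₂ P Q + K₂ Q P) →
      0 ≤ ∑ ω ∈ Finset.univ.filter (fun ω : Set (Sym2 V) => y ∈ openCluster (ω ∩ E₁) s),
        K₁ (openCluster (ω ∩ E₁) s) (openCluster (ωᶜ ∩ E₁) s) * K₂ (openCluster (ω ∩ E₁) s) (openCluster (ωᶜ ∩ E₁) s))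
    {F G : Set V → ℝ} (hF : Monotone F) (hG : Monotone G) :
    0 ≤ ∑ ω ∈ Finset.univ.filter (fun ω : Set (Sym2 V) =>
        ¬ ((openGraph (ω ∩ E)).Reachable s x ∧ (openGraph (ωᶜ ∩ E)).Reachable s x)),
      (F (openCluster (ω ∩ E) s) - F (openCluster (ωᶜ ∩ E) s)) * (G (openCluster (ω ∩ E) s) - G (openCluster (ωᶜ ∩ E) s)) := by
  refine deg2_vertex_of_termTwo hxs hxy hxz hyz he hf hdeg hg hF hG ?_
  rw [hE']
  exact Cut.cutVertex_termTwo_nonneg E₁ E₂ s y z x U₁ U₂ hU hs₁ hs₂ hE₁ hE₂ hdis hyU hzU hplus hF hG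

end DegTwo

end Antithetic

end Summit.CriticalPhenomena.PercolationContinuityZ3.Theorems
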